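import Mathlib
import Summits.ValiantsHypothesis.ValiantsHypothesis.Theorems.TwoProducts.RankTwoJacobian
import HarnessLib

/-!
# ESCAPE ACCOUNTING at rung 3-AFF (and for any composition `P(w₀,w₁,w₂)`): every vertex of `Newt P̃(w)` is THIN or ONE SWAP
away from an EXACTLY CANCELLED formal monomial — so `nv ≤ |supp P|·(t+1)³ + 3t²·#cancelled`

NEGATIVE lane (val-neg-1 g10; critic of record val-idea-crit-8 g4, T1 price list 2026-08-29T06:03:38Z, item T1-D «found-nothing + typed
obstruction»), filed `--supports stmt-ValiantsHypothesis-5906` (crux `TwoProducts`).  Closes NO item; proves NO summit statement; does NOT prove or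
refute `RankThreeAffineLaw` / `RankThreeAffineLawExp` (val-idea-35 g10, `Cruxes/TwoProducts/RankThreeWronskian_val_idea_35_g10.lean` rev 4,
l.2076 / l.2366), `TwoProducts`, `PlanarCellBound`, `ResidualLawV25` or VP ≠ VNP.  0 `def`s, 0 `sorry`.  Vocabulary `Poly2` / `emb` / `nv` by import
from ✓ `Theorems/TwoProducts/RankTwoJacobian.lean`; `k • S` below is Mathlib's ITERATED SUMSET of a `Finset` of exponents (`open scoped Pointwise`).

SETTING.  `P : MvPolynomial (Fin 3) ℂ` (any number of monomials), carriers `w : Fin 3 → Poly2` with supports `Sᵢ`, `|Sᵢ| ≤ t`.  The FORMAL CLOUD of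
the composition is `C(P,w) = ⋃_{α ∈ supp P} (α₀•S₀ + α₁•S₁ + α₂•S₂)`; `supp P̃(w) ⊆ C(P,w)` (`support_aeval_subset_cloud`), and
`F = C(P,w) \ supp P̃(w)` is the set of formal monomials that CANCEL EXACTLY.  A cloud point is THIN if it is `α₀•s₀ + α₁•s₁ + α₂•s₂` (one letter
per block; `≤ |supp P|·(t+1)³` of them).

THEOREMS (all kernel-checked, elementary).
* `not_extreme_of_midpoint` — a support point that is the midpoint of two distinct support points is not a vertex.
* `mem_nsmul_thin_or_swap` — a point of the iterated sumset `k • S` is `k • s` (or `0`), or it is `r + s + s'` with two DISTINCT letters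
  `s ≠ s'` whose two SWAPS `r + s + s`, `r + s' + s'` lie in `k • S` again (and average to it).
* `extremePoints_subset_thin_union_guards` / `ncard_extremePoints_le` — ABSTRACT ACCOUNTING: if every point of `X ⊆ C` is thin (`∈ T`) or has
  two distinct swaps in `C`, then every vertex of `conv X` is in `T` or of the form `f + s − s'` with `f ∈ C \ X`, `s, s' ∈ Sᵢ`; hence
  `#vertices ≤ |T| + |C \ X| · Σᵢ |Sᵢ|²`.
* ★ `nv_aeval_le_thin_add_cancelled` — for every `P`, `w`, `t` with `|Sᵢ| ≤ t`:
  `nv (aeval w P) ≤ |supp P|·(t+1)³ + 3t²·|C(P,w) \ supp (aeval w P)|`, and ★ `nv_aeval_le_of_totalDegree_le` — the same with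
  `|supp P| ≤ (m+1)³` when `P.totalDegree ≤ m`.

READING FOR THE REFUTE LENS (honest; numbers, not adjectives).  The POLY-currency onset `RankThreeAffineLaw` asks `nv ≤ (m+2)^c (t+2)^c`.  By ★, a
family ESCAPING it must have `|F| = #exactly-cancelled formal monomials of P∘w` SUPERPOLYNOMIAL in `(m+2)(t+2)` — generic coefficients cancel at
most `C(m+3,3) + 3t − 1` cloud points, so an escape is a STRUCTURED algebraic identity among three `t`-sparse carriers leaving a residue in convex
position; this quantifies val-idea-35 g10's (s1) residue «a carry that annihilates» (`noAnnihilation_nv_le`: with NO inter-layer annihilation the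
law holds with c = 23), which in addition forces at least one of the cancellations to be INTER-layer.  The bound is attained in order of magnitude
per cancelled point: `P = x₀^a − x₂`, `w₀ = x^{s₁} + Σ_{j≥2} x^{s_j}` with `s₁` far from a concave arc `s₂…s_t`, `w₂ = x^{a•s₁}` cancels ONE cloud
point and exposes the `t − 1` vertices `(a−1)•s₁ + s_j` (paper remark, not formalised here).  No escape family was found (designs tried, all
polynomial: t = 1 GAP carving; scale-separated spikes; uniform convex carriers; `(1+u, 1+v, 1+uv)`; digit/cyclotomic identities; generic
coefficients) — memo `pub/val-lit/neg/neg1g10/READ-neg1g10-5906-T1D-found-nothing.md`.  [folklore]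
-/

noncomputable section
set_option linter.dupNamespace false

namespace Summit.ValiantsHypothesis.ValiantsHypothesis.Theorems.TwoProducts.Negative.EscapeAccounting

open scoped BigOperators Pointwise
open MvPolynomial
open Summit.ValiantsHypothesis.ValiantsHypothesis.Theorems.TwoProducts.RankTwoJacobian (Poly2 emb nv)

/-! ### 1. Planar geometry: the midpoint of two distinct support points is not a vertex -/

/-- In `ℕ²`, `s + s = s' + s'` forces `s = s'`. [folklore] -/
theorem eq_of_two_mul_eq {s s' : Fin 2 →₀ ℕ} (h : s + s = s' + s') : s = s' := by
  ext i
  have := congrArg (fun e : Fin 2 →₀ ℕ => e i) h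
  simp only [Finsupp.add_apply] at this
  omega

/-- A support point which is the MIDPOINT of two distinct support points is not a vertex of the Newton polygon. [folklore] -/
theorem not_extreme_of_midpoint {S : Set (Fin 2 →₀ ℕ)} {p q₁ q₂ : Fin 2 →₀ ℕ}
    (h₁ : q₁ ∈ S) (h₂ : q₂ ∈ S) (hne : q₁ ≠ q₂) (hsum : q₁ + q₂ = p + p) :
    emb p ∉ Set.extremePoints ℝ (convexHull ℝ (emb '' S)) := by
  -- `emb` is additive and injective (inlined: the named forms exist elsewhere in the tree for other embeddings)
  have emb_add : ∀ a b : Fin 2 →₀ ℕ, emb (a + b) = emb a + emb b := fun a b => by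
    funext i
    simp [emb, Finsupp.add_apply, Nat.cast_add]
  have emb_inj : ∀ a b : Fin 2 →₀ ℕ, emb a = emb b → a = b := fun a b h => by
    ext i
    have := congrFun h i
    simpa [emb] using this
  intro hp
  rw [mem_extremePoints] at hp
  have hx₁ : emb q₁ ∈ convexHull ℝ (emb '' S) := subset_convexHull ℝ _ ⟨q₁, h₁, rfl⟩
  have hx₂ : emb q₂ ∈ convexHull ℝ (emb '' S) := subset_convexHull ℝ _ ⟨q₂, h₂, rfl⟩
  have h2 : emb q₁ + emb q₂ = emb p + emb p := by rw [← emb_add, ← emb_add, hsum]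
  have hseg : emb p ∈ openSegment ℝ (emb q₁) (emb q₂) := by
    refine ⟨1 / 2, 1 / 2, by norm_num, by norm_num, by norm_num, ?_⟩
    rw [← smul_add, h2, ← two_smul ℝ (emb p), smul_smul]
    norm_num
  have h := hp.2 _ hx₁ _ hx₂ hseg
  exact hne (emb_inj _ _ (h.1.trans h.2.symm))

/-! ### 2. Iterated sumsets: thin points and swaps -/

/-- `k • s ∈ k • S` for `s ∈ S`. [folklore] -/
theorem nsmul_mem_nsmul {S : Finset (Fin 2 →₀ ℕ)} {s : Fin 2 →₀ ℕ} (hs : s ∈ S) : ∀ k : ℕ, k • s ∈ k • S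
  | 0 => by rw [zero_nsmul, zero_nsmul]; exact Finset.mem_zero.mpr rfl
  | k + 1 => by rw [succ_nsmul, succ_nsmul]; exact Finset.add_mem_add (nsmul_mem_nsmul hs k) hs

/-- Induction form of the thin-or-swap dichotomy on `(k+1) • S`. [folklore] -/
theorem mem_succ_nsmul_thin_or_swap (S : Finset (Fin 2 →₀ ℕ)) : ∀ (k : ℕ) (p : Fin 2 →₀ ℕ), p ∈ (k + 1) • S →
    (∃ s ∈ S, p = (k + 1) • s) ∨
    (∃ s ∈ S, ∃ s' ∈ S, s ≠ s' ∧ ∃ r, p = r + s + s' ∧ ∀ a ∈ S, ∀ b ∈ S, r + a + b ∈ (k + 1) • S)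
  | 0, p, hp => by
      rw [zero_add, one_nsmul] at hp
      exact Or.inl ⟨p, hp, by rw [zero_add, one_nsmul]⟩
  | k + 1, p, hp => by
      rw [succ_nsmul, Finset.mem_add] at hp
      obtain ⟨q, hq, c, hc, rfl⟩ := hp
      rcases mem_succ_nsmul_thin_or_swap S k q hq with ⟨s, hs, rfl⟩ | ⟨s, hs, s', hs', hne, r, rfl, hr⟩
      · by_cases hcs : c = s
        · subst hcs
          exact Or.inl ⟨c, hc, by rw [succ_nsmul _ (k + 1)]⟩
        · refine Or.inr ⟨s, hs, c, hc, Ne.symm hcs, k • s, by rw [succ_nsmul], fun a ha b hb => ?_⟩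
          rw [succ_nsmul, succ_nsmul]
          exact Finset.add_mem_add (Finset.add_mem_add (nsmul_mem_nsmul hs k) ha) hb
      · refine Or.inr ⟨s, hs, s', hs', hne, r + c, by abel, fun a ha b hb => ?_⟩
        have h := Finset.add_mem_add (hr a ha b hb) hc
        rw [succ_nsmul _ (k + 1)]
        convert h using 1
        abel

/-- **THIN OR SWAP.** A point of the iterated sumset `k • S` is `0` or `k • s` (`s ∈ S`), or it is `r + s + s'` with DISTINCT letters
`s ≠ s' ∈ S` such that both swaps `r + s + s`, `r + s' + s'` lie in `k • S` (their sum is `2p`). [folklore] -/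
theorem mem_nsmul_thin_or_swap (S : Finset (Fin 2 →₀ ℕ)) (k : ℕ) (p : Fin 2 →₀ ℕ) (hp : p ∈ k • S) :
    p ∈ insert 0 (S.image fun s => k • s) ∨
    (∃ s ∈ S, ∃ s' ∈ S, s ≠ s' ∧ ∃ r, p = r + s + s' ∧ r + s + s ∈ k • S ∧ r + s' + s' ∈ k • S) := by
  cases k with
  | zero =>
      rw [zero_nsmul] at hp
      exact Or.inl (Finset.mem_insert.mpr (Or.inl (Finset.mem_zero.mp hp)))
  | succ k =>
      rcases mem_succ_nsmul_thin_or_swap S k p hp with ⟨s, hs, rfl⟩ | ⟨s, hs, s', hs', hne, r, rfl, hr⟩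
      · exact Or.inl (Finset.mem_insert.mpr (Or.inr (Finset.mem_image.mpr ⟨s, hs, rfl⟩)))
      · exact Or.inr ⟨s, hs, s', hs', hne, r, rfl, hr s hs s hs, hr s' hs' s' hs'⟩

/-- Swaps survive adding a second block on the right. [folklore] -/
theorem swap_add_right {S A B : Finset (Fin 2 →₀ ℕ)} {a b : Fin 2 →₀ ℕ}
    (ha : ∃ s ∈ S, ∃ s' ∈ S, s ≠ s' ∧ ∃ r, a = r + s + s' ∧ r + s + s ∈ A ∧ r + s' + s' ∈ A) (hb : b ∈ B) :
    ∃ s ∈ S, ∃ s' ∈ S, s ≠ s' ∧ ∃ r, a + b = r + s + s' ∧ r + s + s ∈ A + B ∧ r + s' + s' ∈ A + B := by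
  obtain ⟨s, hs, s', hs', hne, r, rfl, h₁, h₂⟩ := ha
  refine ⟨s, hs, s', hs', hne, r + b, by abel, ?_, ?_⟩
  · convert Finset.add_mem_add h₁ hb using 1; abel
  · convert Finset.add_mem_add h₂ hb using 1; abel

/-- Swaps survive adding a second block on the left. [folklore] -/
theorem swap_add_left {S A B : Finset (Fin 2 →₀ ℕ)} {a b : Fin 2 →₀ ℕ} (hb : b ∈ B)
    (ha : ∃ s ∈ S, ∃ s' ∈ S, s ≠ s' ∧ ∃ r, a = r + s + s' ∧ r + s + s ∈ A ∧ r + s' + s' ∈ A) :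
    ∃ s ∈ S, ∃ s' ∈ S, s ≠ s' ∧ ∃ r, b + a = r + s + s' ∧ r + s + s ∈ B + A ∧ r + s' + s' ∈ B + A := by
  rw [add_comm b a, add_comm B A]
  exact swap_add_right ha hb

/-! ### 3. Abstract accounting: vertices are thin or one swap from a cancelled point -/

/-- **ACCOUNTING (set level).**  `X ⊆ C`; every point of `X` is thin (`∈ T`) or has two distinct swaps inside `C` (letters from one `Sᵢ`).
Then every vertex of `conv X` is thin or equals `f + s − s'` with `f ∈ C \ X` CANCELLED and `s, s' ∈ Sᵢ`. [folklore] -/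
theorem extremePoints_subset_thin_union_guards (X C T : Finset (Fin 2 →₀ ℕ)) (S : Fin 3 → Finset (Fin 2 →₀ ℕ))
    (hrep : ∀ p ∈ X, p ∈ T ∨
      ∃ i, ∃ s ∈ S i, ∃ s' ∈ S i, s ≠ s' ∧ ∃ r, p = r + s + s' ∧ r + s + s ∈ C ∧ r + s' + s' ∈ C) :
    Set.extremePoints ℝ (convexHull ℝ (emb '' (X : Set (Fin 2 →₀ ℕ)))) ⊆
      emb '' ((T ∪ (((C \ X) ×ˢ (Finset.univ.sigma fun i => S i ×ˢ S i)).image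
        fun x => x.1 + x.2.2.1 - x.2.2.2) : Finset (Fin 2 →₀ ℕ)) : Set (Fin 2 →₀ ℕ)) := by
  intro v hv
  obtain ⟨p, hpX, rfl⟩ := extremePoints_convexHull_subset hv
  have hpX' : p ∈ X := Finset.mem_coe.mp hpX
  refine ⟨p, Finset.mem_coe.mpr (Finset.mem_union.mpr ?_), rfl⟩
  rcases hrep p hpX' with hT | ⟨i, s, hs, s', hs', hne, r, rfl, hq₁, hq₂⟩
  · exact Or.inl hT
  · right
    by_cases hX₁ : r + s + s ∈ X
    · by_cases hX₂ : r + s' + s' ∈ X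
      · exfalso
        refine not_extreme_of_midpoint (Finset.mem_coe.mpr hX₁) (Finset.mem_coe.mpr hX₂) ?_ ?_ hv
        · intro h
          have h' : s + s = s' + s' := by
            have := h
            rw [add_assoc, add_assoc] at this
            exact add_left_cancel this
          exact hne (eq_of_two_mul_eq h')
        · abel
      · refine Finset.mem_image.mpr ⟨(r + s' + s', ⟨i, (s, s')⟩), ?_, ?_⟩
        · exact Finset.mem_product.mpr ⟨Finset.mem_sdiff.mpr ⟨hq₂, hX₂⟩,
            Finset.mem_sigma.mpr ⟨Finset.mem_univ _, Finset.mem_product.mpr ⟨hs, hs'⟩⟩⟩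
        · show r + s' + s' + s - s' = r + s + s'
          rw [show r + s' + s' + s = r + s + s' + s' by abel, add_tsub_cancel_right]
    · refine Finset.mem_image.mpr ⟨(r + s + s, ⟨i, (s', s)⟩), ?_, ?_⟩
      · exact Finset.mem_product.mpr ⟨Finset.mem_sdiff.mpr ⟨hq₁, hX₁⟩,
          Finset.mem_sigma.mpr ⟨Finset.mem_univ _, Finset.mem_product.mpr ⟨hs', hs⟩⟩⟩
      · show r + s + s + s' - s = r + s + s'
        rw [show r + s + s + s' = r + s + s' + s by abel, add_tsub_cancel_right]

/-- **ACCOUNTING (count).** Under the same hypothesis, `#vertices(conv X) ≤ |T| + |C \ X| · Σᵢ |Sᵢ|²`. [folklore] -/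
theorem ncard_extremePoints_le (X C T : Finset (Fin 2 →₀ ℕ)) (S : Fin 3 → Finset (Fin 2 →₀ ℕ))
    (hrep : ∀ p ∈ X, p ∈ T ∨
      ∃ i, ∃ s ∈ S i, ∃ s' ∈ S i, s ≠ s' ∧ ∃ r, p = r + s + s' ∧ r + s + s ∈ C ∧ r + s' + s' ∈ C) :
    (Set.extremePoints ℝ (convexHull ℝ (emb '' (X : Set (Fin 2 →₀ ℕ))))).ncard ≤
      T.card + (C \ X).card * ∑ i, (S i).card * (S i).card := by
  set G := ((C \ X) ×ˢ (Finset.univ.sigma fun i => S i ×ˢ S i)).image fun x => x.1 + x.2.2.1 - x.2.2.2 with hG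
  have hsub := extremePoints_subset_thin_union_guards X C T S hrep
  rw [← hG] at hsub
  have hGc : G.card ≤ (C \ X).card * ∑ i, (S i).card * (S i).card := by
    calc G.card ≤ ((C \ X) ×ˢ (Finset.univ.sigma fun i => S i ×ˢ S i)).card := Finset.card_image_le
      _ = (C \ X).card * ∑ i, (S i).card * (S i).card := by
          rw [Finset.card_product, Finset.card_sigma]
          simp [Finset.card_product]
  calc (Set.extremePoints ℝ (convexHull ℝ (emb '' (X : Set (Fin 2 →₀ ℕ))))).ncard
      ≤ (emb '' ((T ∪ G : Finset (Fin 2 →₀ ℕ)) : Set (Fin 2 →₀ ℕ))).ncard :=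
        Set.ncard_le_ncard hsub ((Finset.finite_toSet _).image _)
    _ ≤ ((T ∪ G : Finset (Fin 2 →₀ ℕ)) : Set (Fin 2 →₀ ℕ)).ncard := Set.ncard_image_le (Finset.finite_toSet _)
    _ = (T ∪ G).card := Set.ncard_coe_finset _
    _ ≤ T.card + G.card := Finset.card_union_le _ _
    _ ≤ T.card + (C \ X).card * ∑ i, (S i).card * (S i).card := by omega

/-! ### 4. The composition: support inside the formal cloud, and the bound -/

/-- `supp (w^k) ⊆ k • supp w`. [folklore] -/
theorem support_pow_subset_nsmul (w : Poly2) : ∀ k : ℕ, (w ^ k).support ⊆ k • w.support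
  | 0 => by
      rw [pow_zero, zero_nsmul]
      intro p hp
      have h1 : p ∈ ({0} : Finset (Fin 2 →₀ ℕ)) := by
        have : (1 : Poly2) = monomial 0 1 := rfl
        rw [this] at hp
        exact support_monomial_subset hp
      exact Finset.mem_zero.mpr (Finset.mem_singleton.mp h1)
  | k + 1 => by
      rw [pow_succ, succ_nsmul]
      exact (support_mul _ _).trans (Finset.add_subset_add (support_pow_subset_nsmul w k) subset_rfl)

/-- The support of one composed monomial lies in its cloud block `α₀•S₀ + α₁•S₁ + α₂•S₂`. [folklore] -/
theorem support_aeval_monomial_subset (w : Fin 3 → Poly2) (α : Fin 3 →₀ ℕ) (c : ℂ) :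
    (aeval w (monomial α c)).support ⊆ (α 0 • (w 0).support + α 1 • (w 1).support) + α 2 • (w 2).support := by
  rw [aeval_monomial, Finsupp.prod_fintype _ _ (fun i => by simp), Fin.prod_univ_three]
  have hC : (algebraMap ℂ Poly2 c) * (w 0 ^ α 0 * w 1 ^ α 1 * w 2 ^ α 2) = c • (w 0 ^ α 0 * w 1 ^ α 1 * w 2 ^ α 2) := by
    rw [Algebra.smul_def]
  rw [hC]
  refine (support_smul).trans ?_
  refine (support_mul _ _).trans (Finset.add_subset_add ?_ (support_pow_subset_nsmul _ _))
  exact (support_mul _ _).trans (Finset.add_subset_add (support_pow_subset_nsmul _ _) (support_pow_subset_nsmul _ _))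

/-- `supp P̃(w)` lies in the FORMAL CLOUD `⋃_{α ∈ supp P} (α₀•S₀ + α₁•S₁ + α₂•S₂)`. [folklore] -/
theorem support_aeval_subset_cloud (P : MvPolynomial (Fin 3) ℂ) (w : Fin 3 → Poly2) :
    (aeval w P).support ⊆
      P.support.biUnion fun α => (α 0 • (w 0).support + α 1 • (w 1).support) + α 2 • (w 2).support := by
  conv_lhs => rw [P.as_sum, map_sum]
  refine (support_sum).trans (Finset.biUnion_subset.mpr fun α hα => ?_)
  exact (support_aeval_monomial_subset w α _).trans
    (Finset.subset_biUnion_of_mem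
      (fun α : Fin 3 →₀ ℕ => (α 0 • (w 0).support + α 1 • (w 1).support) + α 2 • (w 2).support) hα)

/-- Every point of `supp P̃(w)` is THIN or has two distinct swaps in the cloud. [folklore] -/
theorem thin_or_swap_of_mem_support (P : MvPolynomial (Fin 3) ℂ) (w : Fin 3 → Poly2) (p : Fin 2 →₀ ℕ)
    (hp : p ∈ (aeval w P).support) :
    p ∈ P.support.biUnion (fun α =>
        (insert 0 ((w 0).support.image fun s => α 0 • s) + insert 0 ((w 1).support.image fun s => α 1 • s)) +
          insert 0 ((w 2).support.image fun s => α 2 • s)) ∨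
    ∃ i, ∃ s ∈ (w i).support, ∃ s' ∈ (w i).support, s ≠ s' ∧ ∃ r, p = r + s + s' ∧
      r + s + s ∈ P.support.biUnion (fun α => (α 0 • (w 0).support + α 1 • (w 1).support) + α 2 • (w 2).support) ∧
      r + s' + s' ∈ P.support.biUnion (fun α => (α 0 • (w 0).support + α 1 • (w 1).support) + α 2 • (w 2).support) := by
  obtain ⟨α, hα, hpα⟩ := Finset.mem_biUnion.mp (support_aeval_subset_cloud P w hp)
  obtain ⟨p01, hp01, p2, hp2, rfl⟩ := Finset.mem_add.mp hpα
  obtain ⟨p0, hp0, p1, hp1, rfl⟩ := Finset.mem_add.mp hp01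
  -- abbreviations for the cloud block and its pieces
  have lift : ∀ {q : Fin 2 →₀ ℕ} {i : Fin 3},
      (∃ s ∈ (w i).support, ∃ s' ∈ (w i).support, s ≠ s' ∧ ∃ r, q = r + s + s' ∧
        r + s + s ∈ (α 0 • (w 0).support + α 1 • (w 1).support) + α 2 • (w 2).support ∧
        r + s' + s' ∈ (α 0 • (w 0).support + α 1 • (w 1).support) + α 2 • (w 2).support) →
      ∃ i, ∃ s ∈ (w i).support, ∃ s' ∈ (w i).support, s ≠ s' ∧ ∃ r, q = r + s + s' ∧
        r + s + s ∈ P.support.biUnion (fun α => (α 0 • (w 0).support + α 1 • (w 1).support) + α 2 • (w 2).support) ∧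
        r + s' + s' ∈ P.support.biUnion (fun α => (α 0 • (w 0).support + α 1 • (w 1).support) + α 2 • (w 2).support) := by
    intro q i h
    obtain ⟨s, hs, s', hs', hne, r, hq, h₁, h₂⟩ := h
    exact ⟨i, s, hs, s', hs', hne, r, hq, Finset.mem_biUnion.mpr ⟨α, hα, h₁⟩, Finset.mem_biUnion.mpr ⟨α, hα, h₂⟩⟩
  rcases mem_nsmul_thin_or_swap _ _ _ hp0 with ht0 | hs0
  · rcases mem_nsmul_thin_or_swap _ _ _ hp1 with ht1 | hs1
    · rcases mem_nsmul_thin_or_swap _ _ _ hp2 with ht2 | hs2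
      · exact Or.inl (Finset.mem_biUnion.mpr ⟨α, hα, Finset.add_mem_add (Finset.add_mem_add ht0 ht1) ht2⟩)
      · exact Or.inr (lift (swap_add_left (Finset.add_mem_add hp0 hp1) hs2))
    · exact Or.inr (lift (swap_add_right (swap_add_left hp0 hs1) hp2))
  · exact Or.inr (lift (swap_add_right (swap_add_right hs0 hp1) hp2))

/-- Size of the thin set: `≤ |supp P|·(t+1)³`. [folklore] -/
theorem card_thin_le (P : MvPolynomial (Fin 3) ℂ) (w : Fin 3 → Poly2) (t : ℕ) (hw : ∀ i, (w i).support.card ≤ t) :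
    (P.support.biUnion fun α =>
        (insert 0 ((w 0).support.image fun s => α 0 • s) + insert 0 ((w 1).support.image fun s => α 1 • s)) +
          insert 0 ((w 2).support.image fun s => α 2 • s)).card ≤ P.support.card * (t + 1) ^ 3 := by
  have hblk : ∀ (i : Fin 3) (k : ℕ), (insert 0 ((w i).support.image fun s => k • s)).card ≤ t + 1 := fun i k =>
    (Finset.card_insert_le _ _).trans (by have := Finset.card_image_le (s := (w i).support) (f := fun s => k • s); have := hw i; omega)
  refine Finset.card_biUnion_le.trans ?_
  calc ∑ α ∈ P.support, ((insert 0 ((w 0).support.image fun s => α 0 • s) +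
          insert 0 ((w 1).support.image fun s => α 1 • s)) + insert 0 ((w 2).support.image fun s => α 2 • s)).card
      ≤ ∑ _α ∈ P.support, (t + 1) ^ 3 := Finset.sum_le_sum fun α _ => by
          refine Finset.card_add_le.trans ?_
          refine (Nat.mul_le_mul Finset.card_add_le (hblk 2 (α 2))).trans ?_
          calc (insert 0 ((w 0).support.image fun s => α 0 • s)).card *
                (insert 0 ((w 1).support.image fun s => α 1 • s)).card * (t + 1)
              ≤ (t + 1) * (t + 1) * (t + 1) :=
                Nat.mul_le_mul_right _ (Nat.mul_le_mul (hblk 0 (α 0)) (hblk 1 (α 1)))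
            _ = (t + 1) ^ 3 := by ring
    _ = P.support.card * (t + 1) ^ 3 := by simp

/-- **★ ESCAPE ACCOUNTING.**  For every `P`, every three carriers with `|supp wᵢ| ≤ t`:
`nv P̃(w) ≤ |supp P|·(t+1)³ + 3t² · #(formal cloud points of P∘w that cancel exactly)`. [folklore] -/
theorem nv_aeval_le_thin_add_cancelled (P : MvPolynomial (Fin 3) ℂ) (w : Fin 3 → Poly2) (t : ℕ)
    (hw : ∀ i, (w i).support.card ≤ t) :
    nv (aeval w P) ≤ P.support.card * (t + 1) ^ 3 + 3 * t ^ 2 *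
      ((P.support.biUnion fun α => (α 0 • (w 0).support + α 1 • (w 1).support) + α 2 • (w 2).support) \
        (aeval w P).support).card := by
  have h := ncard_extremePoints_le (aeval w P).support
    (P.support.biUnion fun α => (α 0 • (w 0).support + α 1 • (w 1).support) + α 2 • (w 2).support)
    (P.support.biUnion fun α =>
        (insert 0 ((w 0).support.image fun s => α 0 • s) + insert 0 ((w 1).support.image fun s => α 1 • s)) +
          insert 0 ((w 2).support.image fun s => α 2 • s))
    (fun i => (w i).support) (fun p hp => thin_or_swap_of_mem_support P w p hp)
  have hsq : ∑ i : Fin 3, (w i).support.card * (w i).support.card ≤ 3 * t ^ 2 := by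
    rw [Fin.sum_univ_three]
    have h0 := Nat.mul_le_mul (hw 0) (hw 0)
    have h1 := Nat.mul_le_mul (hw 1) (hw 1)
    have h2 := Nat.mul_le_mul (hw 2) (hw 2)
    nlinarith
  have hthin := card_thin_le P w t hw
  unfold nv
  calc _ ≤ _ := h
    _ ≤ P.support.card * (t + 1) ^ 3 + ((P.support.biUnion fun α =>
          (α 0 • (w 0).support + α 1 • (w 1).support) + α 2 • (w 2).support) \ (aeval w P).support).card * (3 * t ^ 2) :=
        add_le_add hthin (Nat.mul_le_mul_left _ hsq)
    _ = _ := by ring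

/-- `|supp P| ≤ (m+1)³` when `P.totalDegree ≤ m`. [folklore] -/
theorem card_support_le_of_totalDegree_le (P : MvPolynomial (Fin 3) ℂ) (m : ℕ) (hP : P.totalDegree ≤ m) :
    P.support.card ≤ (m + 1) ^ 3 := by
  have hsub : P.support ⊆ (Fintype.piFinset fun _ : Fin 3 => Finset.range (m + 1)).image
      (fun f => Finsupp.equivFunOnFinite.symm f) := by
    intro α hα
    refine Finset.mem_image.mpr ⟨fun i => α i, Fintype.mem_piFinset.mpr fun i => Finset.mem_range.mpr ?_, ?_⟩
    · have := (monomial_le_degreeOf i hα).trans (degreeOf_le_totalDegree P i)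
      omega
    · ext i; simp
  calc P.support.card ≤ _ := Finset.card_le_card hsub
    _ ≤ (Fintype.piFinset fun _ : Fin 3 => Finset.range (m + 1)).card := Finset.card_image_le
    _ = (m + 1) ^ 3 := by rw [Fintype.card_piFinset]; simp

/-- **★ ESCAPE ACCOUNTING in the onset's currency.**  `P.totalDegree ≤ m`, `|supp wᵢ| ≤ t` ⇒
`nv P̃(w) ≤ (m+1)³(t+1)³ + 3t² · #cancelled cloud points`.  Contrapositive (refute lens): a family with
`nv P̃(w) > (m+2)^c (t+2)^c` for every `c` cancels superpolynomially many formal monomials exactly. [folklore] -/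
theorem nv_aeval_le_of_totalDegree_le (P : MvPolynomial (Fin 3) ℂ) (w : Fin 3 → Poly2) (m t : ℕ)
    (hP : P.totalDegree ≤ m) (hw : ∀ i, (w i).support.card ≤ t) :
    nv (aeval w P) ≤ (m + 1) ^ 3 * (t + 1) ^ 3 + 3 * t ^ 2 *
      ((P.support.biUnion fun α => (α 0 • (w 0).support + α 1 • (w 1).support) + α 2 • (w 2).support) \
        (aeval w P).support).card :=
  (nv_aeval_le_thin_add_cancelled P w t hw).trans
    (Nat.add_le_add_right (Nat.mul_le_mul_right _ (card_support_le_of_totalDegree_le P m hP)) _)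

/--
info: 'Summit.ValiantsHypothesis.ValiantsHypothesis.Theorems.TwoProducts.Negative.EscapeAccounting.nv_aeval_le_of_totalDegree_le' depends on axioms: [propext,
 Classical.choice,
 Quot.sound]
-/
#guard_msgs in
#print axioms nv_aeval_le_of_totalDegree_le

end Summit.ValiantsHypothesis.ValiantsHypothesis.Theorems.TwoProducts.Negative.EscapeAccounting

end
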